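/-
[OURS · L1 W4.5(b) · EL♮(3)] SPECIMEN-TC⁺ (quartic, one inner step (i)) — the clauses of the inner step and of the final step through the chart at the inner point.
-/
import Summits.ResolutionOfSingularities.ResolutionOfSingularities.Theorems.EquisingularLiftEquisingularLiftNatSpecimenQuarticTcPlusEngineLine
import Summits.ResolutionOfSingularities.ResolutionOfSingularities.Theorems.EquisingularLiftEquisingularLiftNatSpecimenQuarticTcPlusRegularityTransport
import Summits.ResolutionOfSingularities.ResolutionOfSingularities.Theorems.EquisingularLiftEquisingularLiftNatSpecimenQuarticTcDeltaChartStep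
import Literature.AlgebraicGeometry.Resolution.AlterationsSemiStableCodimTwoBlowupFibres
import HarnessLib

/-!
# [OURS · L1 W4.5(b) · EL♮(3)] SPECIMEN-TC⁺ for the quartic — part IS = β2: the clauses of ONE INNER STEP (i) and of the FINAL STEP, through the
# chart `u : Spec k[X] → Y` centred at the inner point
# (crux `EquisingularLiftNatThree` = stmt-ResolutionOfSingularities-20148; res-L1-w45b-lead-2 DEALS (D2) 2026-08-27T11:55:26Z «NON-VACUITY
# CERTIFICATES TC⁺»; scoping memo D/res-D-pv-034/SPECIMEN-TCPLUS-SCOPE.md §5 (β2); helper, closes nothing)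

HONEST FRAMING. OURS (cell `res-hironaka`, chain w45b, slot W4.5(b)); NOT a statement of any manuscript; AI-written, weaker than expert review.

Setting: an ambient `Y` (the once blown-up `ℙ³`), an open-immersion chart `u : Spec k[X₀,X₁,X₂] → Y` with `x₀ = u(o)` closed, a closed `T ⊆ Y`
(the strict transform of the quartic) and a closed `Z ⊆ T` (the carrier line) with `𝓘_Z · 𝒪 = (X₁, X₂)~` on the chart and `V(Z)_red` regular;
`b : Y′ → Y` ANY blow-up at `x₀` (the inner step of type (i) of the registered stub `stub_elnat_tcPlusPointResolution`). With
`T₉ = closure b⁻¹(T ∖ {x₀})`, `Z₉ = closure b⁻¹(Z ∖ {x₀})` this file proves the inputs of the FINAL clause of the TC⁺ closure: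
* `lineStrict_subset_strict` : `Z₉ ⊆ T₉`;
* `not_strict_subset_lineStrict` : `¬ T₉ ⊆ Z₉` (from `¬ T ⊆ Z`; the blow-up is an isomorphism off `x₀`);
* `isRegular_lineStrict` / `finite_nonregular_lineStrict` : `V(Z₉)_red` is regular (over `x₀`: the engine charts of `…TcPlusEngineLine`, the
  strict transform of the line is empty or the line `V(X₁/X₀, X₂/X₀)`; off `x₀`: transport along the isomorphism, `…TcPlusRegularityTransport`),
  so its non-regular locus is finite;
and of the inner constructor: `exists_point_carrier` (a point of `V(closure Z)_red` over `x₀`), `isRegularLocalRing_carrier` (the carrier is regular there).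

References: Hartshorne II Prop. 7.16, Ex. 3.2.6; Stacks 0804, 080E; Görtz–Wedhorn I Prop. 13.91 (via the cited tree files).
-/

set_option linter.dupNamespace false -- mandated namespace `Summit.<Summit>.<Problem>` of this single-conjunct summit

noncomputable section

open CategoryTheory CategoryTheory.Limits AlgebraicGeometry TopologicalSpace
open MvPolynomial
open AlgebraicGeometry.Scheme.IdealSheafData
open Literature.AlgebraicGeometry.Resolution
open Summit.ResolutionOfSingularities.ResolutionOfSingularities.Theorems.EquisingularLift

namespace Summit.ResolutionOfSingularities.ResolutionOfSingularities.Cruxes.EquisingularLiftNat.Sections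

namespace SpecimenQuarticTcPlus

open SpecimenQuarticTcDelta

section InnerStep

variable {k : Type} [Field k]
variable {Y : Scheme.{0}} (u : Spec (CommRingCat.of (MvPolynomial (Fin 3) k)) ⟶ Y) [IsOpenImmersion u]
variable (hc : IsClosed ({u (o k)} : Set Y))
variable {T : Set Y} (hTc : IsClosed T)
variable {Z : Set Y} (hZc : IsClosed Z) (hZT : Z ⊆ T)
variable (huZ : (vanishingIdeal (⟨Z, hZc⟩ : Closeds Y)).comap u =
    ofIdealTop ((Ideal.span (Set.range (WhitneyCubic.cen k))).map (Scheme.ΓSpecIso (CommRingCat.of (MvPolynomial (Fin 3) k))).inv.hom))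
variable {Y' : Scheme.{0}} {b : Y' ⟶ Y}

/-! ## `Z₉ ⊆ T₉` and `¬ T₉ ⊆ Z₉` -/

omit [IsOpenImmersion u] in
include hZT in
/-- **`Z₉ ⊆ T₉`**: the strict transform of the carrier line lies on the strict transform of the surface. [folklore] -/
theorem lineStrict_subset_strict (b : Y' ⟶ Y) : closure (b ⁻¹' (Z \ {u (o k)})) ⊆ closure (b ⁻¹' (T \ {u (o k)})) :=
  closure_mono (Set.preimage_mono (Set.sdiff_subset_sdiff_left hZT))

omit [IsOpenImmersion u] in
include hZc in
/-- `Z₉ ⊆ b⁻¹ Z`. [folklore] -/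
theorem lineStrict_subset_preimage (b : Y' ⟶ Y) : closure (b ⁻¹' (Z \ {u (o k)})) ⊆ b ⁻¹' Z :=
  closure_minimal (Set.preimage_mono Set.sdiff_subset) (hZc.preimage b.continuous)

omit [IsOpenImmersion u] in
include hZc in
/-- **`¬ T₉ ⊆ Z₉`**: a point of `T` off `Z` (hence off `x₀ ∈ Z`) has a preimage under the blow-up, on `T₉` but off `b⁻¹Z ⊇ Z₉`.
[OURS · TC⁺ final clause input] [cite: GortzWedhorn2020, Prop. 13.91] -/
theorem not_strict_subset_lineStrict (hx₀Z : u (o k) ∈ Z) (hTZ : ¬ T ⊆ Z)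
    (hb : IsBlowup b (vanishingIdeal (⟨{u (o k)}, hc⟩ : Closeds Y))) :
    ¬ (closure (b ⁻¹' (T \ {u (o k)})) ⊆ closure (b ⁻¹' (Z \ {u (o k)}))) := by
  intro hsub
  obtain ⟨t, htT, htZ⟩ := Set.not_subset.mp hTZ
  have ht : t ≠ u (o k) := fun h => htZ (h ▸ hx₀Z)
  let O : Y.Opens := ⟨{u (o k)}ᶜ, hc.isOpen_compl⟩
  haveI : IsIso (b ∣_ O) := hb.isIso_morphismRestrict (by
    rw [Scheme.IdealSheafData.coe_support_vanishingIdeal]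
    exact disjoint_compl_left)
  obtain ⟨y, hy⟩ := exists_preimage_singleton_eq_singleton_of_isIso_morphismRestrict b O (y := t) ht
  have hyt : b y = t := by
    have : y ∈ b ⁻¹' {t} := by rw [hy]; exact Set.mem_singleton y
    exact this
  have hy₁ : y ∈ closure (b ⁻¹' (T \ {u (o k)})) := by
    refine subset_closure ⟨?_, ?_⟩
    · have h1 : b y ∈ T := by rw [hyt]; exact htT
      exact h1
    · have h1 : b y ∉ ({u (o k)} : Set Y) := by rw [hyt, Set.mem_singleton_iff]; exact ht
      exact h1
  have hy₂ := lineStrict_subset_preimage u hZc b (hsub hy₁)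
  rw [Set.mem_preimage, hyt] at hy₂
  exact htZ hy₂

/-! ## `V(Z₉)_red` is regular -/

include huZ in
/-- **`V(Z₉)_red` is regular** when `V(Z)_red` is: over the centre use the charts (`Z₉` is empty on the `X₁`/`X₂`-charts and the line
`V(X₁/X₀, X₂/X₀)` with regular quotient on the `X₀`-chart); off the centre the blow-up is an isomorphism. [OURS · TC⁺ final clause input «Sing finite»]
[cite: Hartshorne1977, II Example 3.2.6] -/
theorem isRegular_lineStrict (hZreg : Scheme.IsRegular (vanishingIdeal (⟨Z, hZc⟩ : Closeds Y)).subscheme)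
    (hb : IsBlowup b (vanishingIdeal (⟨{u (o k)}, hc⟩ : Closeds Y))) :
    Scheme.IsRegular (vanishingIdeal (⟨closure (b ⁻¹' (Z \ {u (o k)})), isClosed_closure⟩ : Closeds Y')).subscheme := by
  have hux : (vanishingIdeal (⟨{u (o k)}, hc⟩ : Closeds Y)).comap u =
      ofIdealTop ((PointBlowup.originIdeal 2 k).map (Scheme.ΓSpecIso (CommRingCat.of (MvPolynomial (Fin 3) k))).inv.hom) :=
    comap_vanishingIdeal_singleton_chart u hc
  have hI := hI_chart u hc hux
  have hZ := hZ_chart u hZc huZ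
  choose c hcoi hco hcb using fun i => exists_chartE (chartOpen u) (chartRingEquiv u) hc hI hb i
  haveI : ∀ i, IsOpenImmersion (c i) := hcoi
  intro z
  set y := (vanishingIdeal (⟨closure (b ⁻¹' (Z \ {u (o k)})), isClosed_closure⟩ : Closeds Y')).subschemeι z with hy
  have hyZ₉ : y ∈ closure (b ⁻¹' (Z \ {u (o k)})) := by
    have h := Set.mem_range_self (f := fun t => (vanishingIdeal (⟨closure (b ⁻¹' (Z \ {u (o k)})), isClosed_closure⟩ :
      Closeds Y')).subschemeι t) z
    rw [range_subschemeι, Scheme.IdealSheafData.coe_support_vanishingIdeal] at h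
    exact h
  by_cases hby : b y = u (o k)
  · -- over the centre: the point lies in one of the three charts
    have hyU : b y ∈ (chartOpen u : Y.Opens) := by rw [hby]; exact mem_chartOpen_of_mem_range u ⟨o k, rfl⟩
    obtain ⟨i, hi⟩ := exists_mem_range_chart hc hI hb c hco hyU
    have hi' : i = 0 ∨ i = 1 ∨ i = 2 := by fin_cases i <;> simp
    rcases hi' with rfl | rfl | rfl
    · haveI := isRegularRing_quotient_span_frac₀ k
      refine isRegularLocalRing_subscheme_of_chart _ (c 0) (Ideal.span {PointBlowup.frac 2 k 0 1, PointBlowup.frac 2 k 0 2}) ?_ z hi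
      rw [comap_vanishingIdeal_of_isOpenImmersion]
      have hpre : (Closeds.preimage (⟨closure (b ⁻¹' (Z \ {u (o k)})), isClosed_closure⟩ : Closeds Y') (c 0).continuous) =
          ⟨PrimeSpectrum.zeroLocus ((Ideal.span {PointBlowup.frac 2 k 0 1, PointBlowup.frac 2 k 0 2} :
            Ideal (PointBlowup.Chart 2 k 0)) : Set (PointBlowup.Chart 2 k 0)), PrimeSpectrum.isClosed_zeroLocus _⟩ :=
        Closeds.ext (preimage_lineStrictTransform_eq₀ hc hI hZ (hcb 0))
      have hv := vanishingIdeal_zeroLocus_Spec (CommRingCat.of (PointBlowup.Chart 2 k 0))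
        ((Ideal.span {PointBlowup.frac 2 k 0 1, PointBlowup.frac 2 k 0 2} : Ideal (PointBlowup.Chart 2 k 0)) : Set (PointBlowup.Chart 2 k 0))
      rw [Ideal.span_eq, radical_span_frac₀] at hv
      rw [hpre]
      exact hv
    · exfalso
      obtain ⟨q, hq⟩ := hi
      have hq' : (c 1) q ∈ closure (b ⁻¹' (Z \ {u (o k)})) := by rw [hq]; exact hyZ₉
      have hq'' : q ∈ (c 1) ⁻¹' closure (b ⁻¹' (Z \ {u (o k)})) := hq'
      rw [preimage_lineStrictTransform_eq_empty₁ hc hI hZ (hcb 1)] at hq''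
      exact hq''
    · exfalso
      obtain ⟨q, hq⟩ := hi
      have hq' : (c 2) q ∈ closure (b ⁻¹' (Z \ {u (o k)})) := by rw [hq]; exact hyZ₉
      have hq'' : q ∈ (c 2) ⁻¹' closure (b ⁻¹' (Z \ {u (o k)})) := hq'
      rw [preimage_lineStrictTransform_eq_empty₂ hc hI hZ (hcb 2)] at hq''
      exact hq''
  · -- off the centre: the blow-up is an isomorphism
    let O : Y.Opens := ⟨{u (o k)}ᶜ, hc.isOpen_compl⟩
    haveI : IsIso (b ∣_ O) := hb.isIso_morphismRestrict (by
      rw [Scheme.IdealSheafData.coe_support_vanishingIdeal]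
      exact disjoint_compl_left)
    have h : closure (b ⁻¹' (Z \ {u (o k)})) ∩ b ⁻¹' (O : Set Y) = b ⁻¹' Z ∩ b ⁻¹' (O : Set Y) :=
      strictTransform_inter_preimage_eq b hc.isOpen_compl hZc rfl (Set.inter_compl_self _)
    exact isRegularLocalRing_subscheme_of_isIso_restrict b O hZc isClosed_closure h (fun x _ => hZreg x) z hby

include huZ in
/-- **«Sing V(Z₉)_red finite»** — in fact empty. [OURS · TC⁺ final clause input] [folklore] -/
theorem finite_nonregular_lineStrict (hZreg : Scheme.IsRegular (vanishingIdeal (⟨Z, hZc⟩ : Closeds Y)).subscheme)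
    (hb : IsBlowup b (vanishingIdeal (⟨{u (o k)}, hc⟩ : Closeds Y))) (hZ₉ : IsClosed (closure (b ⁻¹' (Z \ {u (o k)})))) :
    Set.Finite {z : (vanishingIdeal (⟨closure (b ⁻¹' (Z \ {u (o k)})), hZ₉⟩ : Closeds Y')).subscheme |
      ¬ IsRegularLocalRing ((vanishingIdeal (⟨closure (b ⁻¹' (Z \ {u (o k)})), hZ₉⟩ : Closeds Y')).subscheme.presheaf.stalk z)} := by
  have hreg := isRegular_lineStrict u hc hZc huZ hZreg hb
  have hempty : {z : (vanishingIdeal (⟨closure (b ⁻¹' (Z \ {u (o k)})), hZ₉⟩ : Closeds Y')).subscheme |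
      ¬ IsRegularLocalRing ((vanishingIdeal (⟨closure (b ⁻¹' (Z \ {u (o k)})), hZ₉⟩ : Closeds Y')).subscheme.presheaf.stalk z)} = ∅ := by
    ext z
    simp only [Set.mem_setOf_eq, Set.mem_empty_iff_false, iff_false, not_not]
    exact hreg z
  rw [hempty]
  exact Set.finite_empty

/-! ## The inputs of the inner constructor at the point `x₀` of the carrier -/

omit [IsOpenImmersion u] in
/-- A point of `V(closure Z)_red` over `x₀ = u(o) ∈ Z`. [folklore] -/
theorem exists_point_carrier (hx₀Z : u (o k) ∈ Z) :
    ∃ y : (vanishingIdeal (⟨closure Z, isClosed_closure⟩ : Closeds Y)).subscheme,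
      (vanishingIdeal (⟨closure Z, isClosed_closure⟩ : Closeds Y)).subschemeι y = u (o k) :=
  exists_point_subscheme_of_mem u hx₀Z

omit [IsOpenImmersion u] in
include hZc in
/-- `V(closure Z)_red = V(Z)_red` is regular everywhere when `V(Z)_red` is. [folklore] -/
theorem isRegularLocalRing_carrier (hZreg : Scheme.IsRegular (vanishingIdeal (⟨Z, hZc⟩ : Closeds Y)).subscheme)
    (y : (vanishingIdeal (⟨closure Z, isClosed_closure⟩ : Closeds Y)).subscheme) :
    IsRegularLocalRing ((vanishingIdeal (⟨closure Z, isClosed_closure⟩ : Closeds Y)).subscheme.presheaf.stalk y) := by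
  have hcl : (⟨closure Z, isClosed_closure⟩ : Closeds Y) = ⟨Z, hZc⟩ := Closeds.ext hZc.closure_eq
  have H : ∀ (C : Closeds Y) (hC : C = ⟨Z, hZc⟩) (y : (vanishingIdeal C).subscheme),
      IsRegularLocalRing ((vanishingIdeal C).subscheme.presheaf.stalk y) := by
    intro C hC y
    subst hC
    exact hZreg y
  exact H _ hcl y

end InnerStep

end SpecimenQuarticTcPlus

end Summit.ResolutionOfSingularities.ResolutionOfSingularities.Cruxes.EquisingularLiftNat.Sections
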